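import Summits.BirchSwinnertonDyer.BirchSwinnertonDyer.Theorems.PrintX10bResplitClosersCoherentPair
import HarnessLib

set_option linter.dupNamespace false -- nested cell layout (D-0017)
set_option autoImplicit false

/-!
# PrintX10b — the (F-411) entry glue `HowardContainmentLightFrameX10bPinnedOfPrintOfPrintMu` holds (plan g12 round-2 turnkey)

Closes `Summit.BirchSwinnertonDyer.BirchSwinnertonDyer.Theses.PrintX10b.HowardContainmentLightFrameX10bPinnedOfPrintOfPrintMu`
(`MuInequalityCoherentPairOfPrint → HowardDVRKolyvaginBound → CGLSHeegnerKolyvaginSystem → HowardContainmentLightFrameX10bPinnedOfPrint`)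
AT ONCE over p649419 (`PrintX10bResplit.howardContainmentLightFrameX10bPinnedOfPrintOfCoherentPair_holds` ∘
`printHypothesesDischargeX10b_holds`).  THEOREMS ONLY; no `sorry`.  CHECK ONLY AFTER the round-2 `route edit` has landed.
Propose: `ledger propose --kind proof --target Summits/BirchSwinnertonDyer/BirchSwinnertonDyer/Theorems/PrintX10bPrintMuEntry.lean
--file PrintX10bPrintMuEntry.lean --workitem <item id of HowardContainmentLightFrameX10bPinnedOfPrintOfPrintMu>`.
Honest framing: bookkeeping; both print leaves stay HYPOTHESES; BSD is NOT proved by this.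
[cite: Howard2004HeegnerKolyvagin, Thm. 1.6.1] [cite: CastellaGrossiLeeSkinner2022, Thm. 4.1.1]
-/

namespace Summit.BirchSwinnertonDyer.BirchSwinnertonDyer.Theorems.PrintX10bPrintMuEntry

open Summit.BirchSwinnertonDyer.BirchSwinnertonDyer.Theses.PrintX10b

/-- **The (F-411) entry glue of PrintX10b holds** (the round-1 → round-2 bridge `muInequalityCoherentPairOfPrint_of_ofHoward`
is the one landed in `PrintX9PrintMuEntry`, same shared text). [cite: Howard2004HeegnerKolyvagin, Thm. 1.6.1]
[cite: CastellaGrossiLeeSkinner2022, Thm. 4.1.1] -/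
theorem howardContainmentLightFrameX10bPinnedOfPrintOfPrintMu_holds :
    HowardContainmentLightFrameX10bPinnedOfPrintOfPrintMu :=
  fun hM hH hK =>
    Summit.BirchSwinnertonDyer.BirchSwinnertonDyer.Theorems.PrintX10bResplit.howardContainmentLightFrameX10bPinnedOfPrintOfCoherentPair_holds
      (hM hH hK)
      Summit.BirchSwinnertonDyer.BirchSwinnertonDyer.Theorems.PrintX10bResplit.printHypothesesDischargeX10b_holds

end Summit.BirchSwinnertonDyer.BirchSwinnertonDyer.Theorems.PrintX10bPrintMuEntry
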